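import Mathlib
import HarnessLib
import Literature.MathematicalPhysics.StatisticalMechanics.WeightTower
import Literature.MathematicalPhysics.StatisticalMechanics.TorusMultiplierMatrices

/-!
# The dominating sequence of the weight tower from Fourier multipliers
# (Adams–Buchholz–Kotecký–Müller, Lemma 7.5 (v) with (7.41)–(7.45), modulo the scalar Lemma 7.3)

[ABKM19] Lemma 7.5 (v) bounds the weight forms by translation-invariant operators,
`A_k^X ⪯ D_k := (λM_k⁻¹ + (1+θ_k) Σ_{j>k} 𝒞_j)⁻¹`, `A_{k:k+1}^X ⪯ (λM_k⁻¹ + (1+θ_k)Σ_{j>k+1}𝒞_j)⁻¹`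
((7.30)), by an induction whose step is the purely Fourier-side Lemma 7.3.  On the torus all these
operators are multiplier matrices (`GradientFRD.mulMat`, `TorusMultiplierMatrices.lean`), so the
hypothesis structure `WeightData.Dominated D` of the abstract tower (`WeightTower.lean`) reduces to
SCALAR statements about the multipliers `m_k(κ)` (of `M_k`), `c_j(κ)` (of `𝒞_j`) at each Fourier
mode.  This file performs that reduction:

* `domMul lam θ m t k κ = (lam·(m k κ)⁻¹ + (1 + θ k)·t k κ)⁻¹` — the multiplier of `D_k` ((7.30); by
  the conventions `0⁻¹ = 0` it vanishes where `m k κ = t k κ = 0`, i.e. on the zero mode);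
* scalar facts: `domMul_nonneg`, the subcriticality `(1+θ̄) c_{k+1} d_k < 1`
  (`cov_mul_domMul_lt_one`), and the transport (7.43)
  `d_k/(1 − (1+θ̄)c_{k+1}d_k) ≤ (lam·m_k⁻¹ + (1+θ_k) t_{k+1})⁻¹` (`step_domMul_le`);
* **`WeightData.dominated_of_multipliers`** — if `W.cov k = mulMat ((1+θ̄)c_{k+1})`, the seeds are
  symmetric, non-negative and `⪯ mulMat d_0`, the added forms are non-negative and
  `⪯ δ'_{k+1} · mulMat m_{k+1}` ((7.3)), and the SCALAR LEMMA 7.3 holds in the form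
  `(lam·m_k⁻¹ + (1+θ_k)t_{k+1})⁻¹ + δ'_{k+1} m_{k+1} ≤ d_{k+1}` at every `κ ≠ 0` ((7.45)), then
  `W.Dominated (k ↦ mulMat d_k)` — hence (by `WeightTower*.lean`) Theorem 7.1 (w1), (w2) shape,
  (w7) shape for `W`.

Everything is proved; no named fact.  What is NOT here: the scalar Lemma 7.3 itself (it needs the
shell bounds of `GradientFRD.TorusFRD` (v)) and the margin `θ·1 − √C D √C ⪰ 0` with `θ < 1`
uniform in `k` (it follows from `lam·m_k⁻¹ ≥` const on the support of `c_{k+1}`, Lemma 7.7).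

## References
* S. Adams, S. Buchholz, R. Kotecký, S. Müller, arXiv:1910.13564, Lemma 7.3, Lemma 7.5 (v),
  (7.41)–(7.45) [AdamsBuchholzKoteckyMuller2019].
-/

noncomputable section

namespace Literature.MathematicalPhysics.StatisticalMechanics.GradientRG

open Finset Matrix
open Literature.MathematicalPhysics.StatisticalMechanics.GradientFRD
  (mulMat mulMat_add mulMat_smul mulMat_one isSymm_mulMat posSemidef_mulMat posSemidef_mulMat_sub
    nextForm_mulMat posDef_one_sub_sqrt_mul_mul_sqrt_mulMat)
open scoped MatrixOrder

/-! ## Scalar facts -/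

section Scalar

/-- **The dominating multiplier** `d = (lam·m⁻¹ + (1+θ)·t)⁻¹` of [ABKM19] (7.30) at one Fourier mode
(`0` where `m = t = 0`). [cite: AdamsBuchholzKoteckyMuller2019, Lemma 7.5 (v) (7.30)] -/
def domScalar (lam θ m t : ℝ) : ℝ := (lam * m⁻¹ + (1 + θ) * t)⁻¹

/-- `d ≥ 0` for `lam, m, t ≥ 0`, `1 + θ ≥ 0`. [cite: AdamsBuchholzKoteckyMuller2019, Lemma 7.5 (i)] -/
theorem domScalar_nonneg {lam θ m t : ℝ} (hlam : 0 ≤ lam) (hθ : 0 ≤ 1 + θ) (hm : 0 ≤ m)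
    (ht : 0 ≤ t) : 0 ≤ domScalar lam θ m t :=
  inv_nonneg.2 (add_nonneg (mul_nonneg hlam (inv_nonneg.2 hm)) (mul_nonneg hθ ht))

/-- **Subcriticality of the dominator** ([ABKM19] (7.42)): if `0 ≤ (1+θ̄)c ≤ (1+θ)t` and
`lam, m > 0`, then `(1+θ̄)c · d < 1`. [cite: AdamsBuchholzKoteckyMuller2019, Lemma 7.5 (7.42)] -/
theorem cov_mul_domScalar_lt_one {lam θ θbar m t c : ℝ} (hlam : 0 < lam) (hm : 0 < m)
    (hc : 0 ≤ (1 + θbar) * c) (hct : (1 + θbar) * c ≤ (1 + θ) * t) :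
    (1 + θbar) * c * domScalar lam θ m t < 1 := by
  have hP : 0 < lam * m⁻¹ + (1 + θ) * t :=
    add_pos_of_pos_of_nonneg (mul_pos hlam (inv_pos.2 hm)) (hc.trans hct)
  rw [domScalar, ← div_eq_mul_inv, div_lt_one hP]
  have : 0 < lam * m⁻¹ := mul_pos hlam (inv_pos.2 hm)
  linarith

/-- On the zero mode (`m = 0`, `c = 0`) subcriticality is trivial. [cite: AdamsBuchholzKoteckyMuller2019, Ch. 7.2] -/
theorem cov_mul_domScalar_lt_one_of_eq_zero {lam θ θbar m t c : ℝ} (hc : c = 0) :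
    (1 + θbar) * c * domScalar lam θ m t < 1 := by
  rw [hc, mul_zero, zero_mul]; exact one_pos

/-- The scalar Gaussian step `x ↦ x/(1 − Cx)` is monotone below `C⁻¹`: for `x ≤ y`, `C y < 1`,
`C ≥ 0`: `x/(1−Cx) ≤ y/(1−Cy)`. [cite: AdamsBuchholzKoteckyMuller2019, Lemma 7.2 (ii)] -/
theorem div_one_sub_mul_mono {C x y : ℝ} (hC : 0 ≤ C) (hxy : x ≤ y) (hy : C * y < 1) :
    x / (1 - C * x) ≤ y / (1 - C * y) := by
  have hx1 : 0 < 1 - C * x := by nlinarith [mul_le_mul_of_nonneg_left hxy hC]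
  have hy1 : 0 < 1 - C * y := by linarith
  rw [div_le_div_iff₀ hx1 hy1]
  nlinarith [mul_le_mul_of_nonneg_left hxy hC]

/-- The scalar Gaussian step of an inverse: `P⁻¹/(1 − C P⁻¹) = (P − C)⁻¹` for `P > C`, `P > 0`
([ABKM19] (7.20) at one mode). [cite: AdamsBuchholzKoteckyMuller2019, Lemma 7.2 (7.20)] -/
theorem inv_div_one_sub_mul_inv {P C : ℝ} (hP : 0 < P) (_hPC : C < P) :
    P⁻¹ / (1 - C * P⁻¹) = (P - C)⁻¹ := by
  have hP0 : P ≠ 0 := hP.ne'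
  field_simp

/-- **Transport of the bound through the step** ([ABKM19] (7.43)): with `d = domScalar lam θ m t`,
`t = c + t'`, `0 ≤ (1+θ̄)c ≤ (1+θ)c` (i.e. `θ̄ ≤ θ`, `c ≥ 0`), `t' ≥ 0`, `lam, m > 0`:
`d/(1 − (1+θ̄)c·d) ≤ (lam·m⁻¹ + (1+θ)t')⁻¹`. [cite: AdamsBuchholzKoteckyMuller2019, Lemma 7.5 (7.43)] -/
theorem step_domScalar_le {lam θ θbar m c t' : ℝ} (hlam : 0 < lam) (hm : 0 < m) (hθbar : 0 ≤ 1 + θbar)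
    (hθ : θbar ≤ θ) (hc : 0 ≤ c) (ht' : 0 ≤ t') :
    domScalar lam θ m (c + t') / (1 - (1 + θbar) * c * domScalar lam θ m (c + t')) ≤
      (lam * m⁻¹ + (1 + θ) * t')⁻¹ := by
  set P := lam * m⁻¹ + (1 + θ) * (c + t') with hPdef
  have hlm : 0 < lam * m⁻¹ := mul_pos hlam (inv_pos.2 hm)
  have hθ' : 0 ≤ 1 + θ := hθbar.trans (by linarith)
  have hP : 0 < P := add_pos_of_pos_of_nonneg hlm (mul_nonneg hθ' (add_nonneg hc ht'))
  have hCP : (1 + θbar) * c < P := by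
    have : (1 + θbar) * c ≤ (1 + θ) * (c + t') := by nlinarith
    linarith
  have hd : domScalar lam θ m (c + t') = P⁻¹ := rfl
  rw [hd, inv_div_one_sub_mul_inv hP hCP]
  -- `(P − (1+θ̄)c)⁻¹ ≤ (lam m⁻¹ + (1+θ)t')⁻¹` since `P − (1+θ̄)c ≥ lam m⁻¹ + (1+θ)t' > 0`
  have hQ : 0 < lam * m⁻¹ + (1 + θ) * t' := add_pos_of_pos_of_nonneg hlm (mul_nonneg hθ' ht')
  refine inv_anti₀ hQ ?_
  rw [hPdef]
  nlinarith

end Scalar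

/-! ## `Dominated` from multipliers -/

section Torus

variable {d M : ℕ} [NeZero M]

/-- The dominating multipliers `d_k(κ) = (lam·m_k(κ)⁻¹ + (1+θ_k) t_k(κ))⁻¹` as functions on the dual
torus. [cite: AdamsBuchholzKoteckyMuller2019, Lemma 7.5 (v) (7.30)] -/
def domMul (lam : ℝ) (θ : ℕ → ℝ) (m t : ℕ → (Fin d → ZMod M) → ℝ) (k : ℕ) (κ : Fin d → ZMod M) : ℝ :=
  domScalar lam (θ k) (m k κ) (t k κ)

/-- **`WeightData.Dominated` from scalar hypotheses on the multipliers** ([ABKM19] Lemma 7.5 (v),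
induction (7.41)–(7.45), with Lemma 7.3 as the scalar hypothesis `h73`).  Data: `lam > 0`; even
multipliers `m k` (positive off the zero mode, zero on it), `c j ≥ 0` (even, zero on the zero mode)
with tails `t k = c (k+1) + t (k+1) ≥ 0`; parameters `θ̄ ≤ θ k`, `1 + θ̄ ≥ 0`, `δ' k ≥ 0`.  If
`W.cov k = mulMat ((1+θ̄) c (k+1))`, the seeds are symmetric, `⪰ 0`, `⪯ mulMat d_0`, the added forms
are `⪰ 0` and `⪯ δ'_{k} · mulMat m_{k}`, and
`(lam·m_k⁻¹ + (1+θ_k)t_{k+1})⁻¹ + δ'_{k+1} m_{k+1} ≤ d_{k+1}` off the zero mode, then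
`W.Dominated (k ↦ mulMat d_k)`. [cite: AdamsBuchholzKoteckyMuller2019, Lemma 7.5 (v)] -/
theorem WeightData.dominated_of_multipliers (W : WeightData (Fin d → ZMod M)) {lam θbar : ℝ}
    {θ : ℕ → ℝ} {δ' : ℕ → ℝ} {m c t : ℕ → (Fin d → ZMod M) → ℝ}
    (hlam : 0 < lam) (hθbar : 0 ≤ 1 + θbar) (hθ : ∀ k, θbar ≤ θ k)
    (hm_even : ∀ k κ, m k (-κ) = m k κ) (hm_pos : ∀ k κ, κ ≠ 0 → 0 < m k κ)
    (hm_zero : ∀ k, m k 0 = 0)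
    (hc_even : ∀ j κ, c j (-κ) = c j κ) (hc_nonneg : ∀ j κ, 0 ≤ c j κ) (hc_zero : ∀ j, c j 0 = 0)
    (ht : ∀ k κ, t k κ = c (k + 1) κ + t (k + 1) κ) (ht_nonneg : ∀ k κ, 0 ≤ t k κ)
    (ht_even : ∀ k κ, t k (-κ) = t k κ) (ht_zero : ∀ k, t k 0 = 0)
    (hcov : ∀ k, W.cov k = mulMat (fun κ => (1 + θbar) * c (k + 1) κ))
    (hseed_symm : ∀ X, (W.seed X).IsSymm) (hseed_psd : ∀ X, (W.seed X).PosSemidef)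
    (hseed_le : ∀ X, (mulMat (domMul lam θ m t 0) - W.seed X).PosSemidef)
    (hpert_psd : ∀ k X, (W.pert k X).PosSemidef)
    (hpert_le : ∀ k X, (δ' k • mulMat (m k) - W.pert k X).PosSemidef)
    (h73 : ∀ k κ, κ ≠ 0 →
      (lam * (m k κ)⁻¹ + (1 + θ k) * t (k + 1) κ)⁻¹ + δ' (k + 1) * m (k + 1) κ ≤
        domMul lam θ m t (k + 1) κ) :
    W.Dominated (fun k => mulMat (domMul lam θ m t k)) := by
  -- evenness / vanishing on the zero mode of the data
  have hd_even : ∀ k κ, domMul lam θ m t k (-κ) = domMul lam θ m t k κ := fun k κ => by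
    simp only [domMul, hm_even, ht_even]
  have hd_zero : ∀ k, domMul lam θ m t k 0 = 0 := fun k => by
    simp [domMul, domScalar, hm_zero, ht_zero]
  have hcc_even : ∀ k κ, (fun κ => (1 + θbar) * c (k + 1) κ) (-κ) = (fun κ => (1 + θbar) * c (k + 1) κ) κ :=
    fun k κ => by simp only [hc_even]
  have hcc0 : ∀ k κ, 0 ≤ (fun κ => (1 + θbar) * c (k + 1) κ) κ :=
    fun k κ => mul_nonneg hθbar (hc_nonneg _ _)
  -- subcriticality `(1+θ̄) c_{k+1} d_k < 1`
  have hsub : ∀ k κ, (fun κ => (1 + θbar) * c (k + 1) κ) κ * domMul lam θ m t k κ < 1 := by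
    intro k κ
    by_cases hκ : κ = 0
    · simp only [hκ, hc_zero, mul_zero, zero_mul]; exact one_pos
    · simp only [domMul]
      refine cov_mul_domScalar_lt_one hlam (hm_pos k κ hκ) (hcc0 k κ) ?_
      rw [ht k κ]
      have h1 := hθ k
      have h2 := hc_nonneg (k + 1) κ
      have h3 := ht_nonneg (k + 1) κ
      nlinarith
  refine
    { seed_isSymm := hseed_symm
      seed_posSemidef := hseed_psd
      seed_le := hseed_le
      pert_posSemidef := hpert_psd
      dom_isSymm := fun k => isSymm_mulMat _
      dom_subcritical := fun k => ?_
      step_le := fun k X => ?_ }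
  · rw [hcov k]
    exact posDef_one_sub_sqrt_mul_mul_sqrt_mulMat (hd_even k) (hcc_even k) (hcc0 k) (hsub k)
  · -- the step: `nextForm D_k = mulMat (d_k/(1 − (1+θ̄)c_{k+1}d_k))`, then scalars
    rw [hcov k, nextForm_mulMat (hd_even k) (hcc_even k) (hcc0 k) (hsub k)]
    set stp : (Fin d → ZMod M) → ℝ := fun κ =>
      domMul lam θ m t k κ / (1 - (1 + θbar) * c (k + 1) κ * domMul lam θ m t k κ) with hstp
    have hscal : ∀ κ, stp κ + δ' (k + 1) * m (k + 1) κ ≤ domMul lam θ m t (k + 1) κ := by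
      intro κ
      by_cases hκ : κ = 0
      · simp [hstp, hκ, hd_zero, hm_zero]
      · have hst : stp κ ≤ (lam * (m k κ)⁻¹ + (1 + θ k) * t (k + 1) κ)⁻¹ := by
          simp only [hstp, domMul]
          rw [ht k κ]
          exact step_domScalar_le hlam (hm_pos k κ hκ) hθbar (hθ k) (hc_nonneg _ _) (ht_nonneg _ _)
        linarith [h73 k κ hκ]
    have hsplit : mulMat (domMul lam θ m t (k + 1)) - (mulMat stp + W.pert (k + 1) X) =
        mulMat (fun κ => domMul lam θ m t (k + 1) κ - (stp κ + δ' (k + 1) * m (k + 1) κ)) +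
          (δ' (k + 1) • mulMat (m (k + 1)) - W.pert (k + 1) X) := by
      rw [GradientFRD.mulMat_sub, mulMat_add, mulMat_smul]
      abel
    rw [hsplit]
    exact (posSemidef_mulMat fun κ => sub_nonneg.2 (hscal κ)).add (hpert_le (k + 1) X)

end Torus

end Literature.MathematicalPhysics.StatisticalMechanics.GradientRG

end
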